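import Summits.AtomisticToContinuum.Crystallization.Theorems.FrustratedLawDichotomyStrainedPatchTaylorChord
import Literature.Analysis.ValidatedNumerics.IntervalGershgorin

/-!
# The curvature-sum floor from ENTRYWISE HESSIAN ENCLOSURES and diagonal dominance (kernel interface of the `λ`-leaf of lever (C))

decomp-a2c hand-1 g26 (crux `AperiodicFrustratedLawGap`, stmt-AtomisticToContinuum-27623; `(H) HomFloor (1/625)`, hcp half; critic row 1026 (C):
«the λ-certificate over the (U, ξ)-box is the open kernel item of (C)»).  `…HomConvexSegmentW45.hcpShifted_floor_W45` needs, at the good parameters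
`s` of the segment, the CURVATURE-SUM floor `λ‖Δ‖² ≤ Σ_b segGd W₁ p_b Δ s` (lens-5's `segGd = W₁′(ρ)σ² + W₁(ρ)(‖Δ‖² − σ²)/ρ`).  This file turns that
into what a Boolean leaf can check:

* §1 `segGd_eq_rankOne` — closed form `segGd = α·⟪c, Δ⟫² + β·‖Δ‖²`, `c = p + sΔ`, `ρ = ‖c‖`, `α = (W₁′(ρ) − W₁(ρ)/ρ)/ρ²`, `β = W₁(ρ)/ρ`: the
  quadratic form of the Hessian `α·ccᵀ + β·1` of `x ↦ W‖x‖` (no unit vectors, no square roots beyond `ρ`);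
* §2 `quadForm_ge_of_dominance` — for a symmetric `3×3` array `M` with `λ + Σ_{j≠i}|M i j| ≤ M i i` (Gershgorin/diagonal dominance of `M − λ1`):
  `λ·Σ x_i² ≤ Σ_{ij} M i j x_i x_j` (from `Literature…IntervalGershgorin.form_ge_diag_sub_offRowSum`); `…_of_enclosure`: the same from entrywise
  enclosures `lo ≤ M ≤ hi` tested on their end points;
* §3 ★★★ `curvatureSum_ge_of_enclosure` — the label sum `Σ_b (α_b⟪c_b, Δ⟫² + β_b‖Δ‖²)` is `≥ λ‖Δ‖²` as soon as the six entries
  `M_ij = Σ_b α_b (c_b)_i (c_b)_j + δ_ij Σ_b β_b` are enclosed by `[lo_ij, hi_ij]` passing the end-point dominance test — EXACTLY the `hcurv` input of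
  `hcpShifted_floor_W45` once `segGd` is rewritten by §1 (the leaf encloses `α_b`, `β_b`, `c_b` over its `(U, ξ)`-box by interval arithmetic).

NO definitions; 0 sorry; standard axioms; no instances / notation / `#eval`.  `--supports stmt-AtomisticToContinuum-27623`.
-/

noncomputable section

namespace Summit.AtomisticToContinuum.Crystallization.Theorems.FrustratedLawDichotomyStrainedPatchHomConvexCurvature

open scoped BigOperators RealInnerProductSpace
open Matrix
open Summit.AtomisticToContinuum.Crystallization.Theorems.FrustratedLawDichotomyStrainedPatchTaylorChord
  (segR segN segS segG segGd segN_eq_inner)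
open Literature.Analysis.ValidatedNumerics.IntervalGershgorin (offRowSum form_ge_diag_sub_offRowSum form_eq_sum_sum)

/-! ## §1. `segGd` as a rank-one-plus-identity quadratic form -/

/-- ★ **Closed form of the curvature term**: with `c = p + sΔ`, `ρ = ‖c‖ ≠ 0`,
`segGd W₁ p Δ s = ((W₁′(ρ) − W₁(ρ)/ρ)/ρ²)·⟪c, Δ⟫² + (W₁(ρ)/ρ)·‖Δ‖²`. [arithmetic] -/
theorem segGd_eq_rankOne (W₁ : ℝ → ℝ) (p Δ : EuclideanSpace ℝ (Fin 3)) {s : ℝ} (h0 : segR p Δ s ≠ 0) :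
    segGd W₁ p Δ s =
      (deriv W₁ (segR p Δ s) - W₁ (segR p Δ s) / segR p Δ s) / segR p Δ s ^ 2 * ⟪p + s • Δ, Δ⟫ ^ 2 +
        W₁ (segR p Δ s) / segR p Δ s * ‖Δ‖ ^ 2 := by
  have hN : segN p Δ s = ⟪p + s • Δ, Δ⟫ := segN_eq_inner p Δ s
  unfold segGd segS
  rw [hN]
  field_simp
  ring

/-! ## §2. Diagonal dominance of a symmetric `3 × 3` array -/

/-- ★ **Dominance ⟹ form floor**: `M` symmetric with `λ + Σ_{j≠i} |M i j| ≤ M i i` for each `i` ⟹ `λ Σ_i x_i² ≤ Σ_i Σ_j M i j x_i x_j`. [folklore: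
Gershgorin / `form_ge_diag_sub_offRowSum`] -/
theorem quadForm_ge_of_dominance (M : Fin 3 → Fin 3 → ℝ) (hsym : ∀ i j, M i j = M j i) {lam : ℝ}
    (hdom : ∀ i, lam + (∑ j, if j = i then 0 else |M i j|) ≤ M i i) (x : Fin 3 → ℝ) :
    lam * ∑ i, x i ^ 2 ≤ ∑ i, ∑ j, M i j * (x i * x j) := by
  have hs : (Matrix.of M)ᵀ = Matrix.of M := by
    ext i j; simp [hsym i j]
  have h := form_ge_diag_sub_offRowSum (Matrix.of M) hs x
  rw [form_eq_sum_sum] at h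
  simp only [Matrix.of_apply, offRowSum] at h
  calc lam * ∑ i, x i ^ 2 = ∑ i, lam * x i ^ 2 := by rw [Finset.mul_sum]
    _ ≤ ∑ i, (M i i - ∑ j, if j = i then 0 else |M i j|) * x i ^ 2 :=
        Finset.sum_le_sum fun i _ => mul_le_mul_of_nonneg_right (by linarith [hdom i]) (sq_nonneg _)
    _ ≤ ∑ i, ∑ j, M i j * (x i * x j) := h

/-- ★ **… from entrywise ENCLOSURES tested on their end points**: `lo i j ≤ M i j ≤ hi i j` and
`λ + Σ_{j≠i} max |lo i j| |hi i j| ≤ lo i i` ⟹ the same floor. [folklore] -/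
theorem quadForm_ge_of_enclosure (M lo hi : Fin 3 → Fin 3 → ℝ) (hsym : ∀ i j, M i j = M j i)
    (hlo : ∀ i j, lo i j ≤ M i j) (hhi : ∀ i j, M i j ≤ hi i j) {lam : ℝ}
    (htest : ∀ i, lam + (∑ j, if j = i then 0 else max |lo i j| |hi i j|) ≤ lo i i) (x : Fin 3 → ℝ) :
    lam * ∑ i, x i ^ 2 ≤ ∑ i, ∑ j, M i j * (x i * x j) := by
  refine quadForm_ge_of_dominance M hsym (fun i => ?_) x
  have habs : ∀ j, |M i j| ≤ max |lo i j| |hi i j| := fun j =>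
    abs_le_max_abs_abs (hlo i j) (hhi i j)
  have hsum : (∑ j, if j = i then 0 else |M i j|) ≤ ∑ j, if j = i then 0 else max |lo i j| |hi i j| :=
    Finset.sum_le_sum fun j _ => by split_ifs <;> [exact le_rfl; exact habs j]
  linarith [htest i, hlo i i]

/-! ## §3. ★★★ The curvature-sum floor from enclosures -/

/-- `⟪c, Δ⟫ = Σ_i c_i Δ_i` on `EuclideanSpace ℝ (Fin 3)`. [arithmetic] -/
theorem inner_eq_sum3 (c Δ : EuclideanSpace ℝ (Fin 3)) : ⟪c, Δ⟫ = ∑ i, c i * Δ i := by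
  rw [PiLp.inner_apply]
  exact Finset.sum_congr rfl fun i _ => by simp [mul_comm]

/-- `⟪c, Δ⟫² = Σ_i Σ_j c_i c_j Δ_i Δ_j`. [arithmetic] -/
theorem inner_sq_eq_sum (c Δ : EuclideanSpace ℝ (Fin 3)) : ⟪c, Δ⟫ ^ 2 = ∑ i, ∑ j, c i * c j * (Δ i * Δ j) := by
  rw [inner_eq_sum3, sq, Finset.sum_mul_sum]
  exact Finset.sum_congr rfl fun i _ => Finset.sum_congr rfl fun j _ => by ring

/-- `‖Δ‖² = Σ_i Δ_i²`. [arithmetic] -/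
theorem norm_sq_eq_sum (Δ : EuclideanSpace ℝ (Fin 3)) : ‖Δ‖ ^ 2 = ∑ i, Δ i ^ 2 := by
  rw [EuclideanSpace.norm_sq_eq]
  exact Finset.sum_congr rfl fun i _ => by rw [Real.norm_eq_abs, sq_abs]

/-- One label's curvature term as a double sum over coordinates. [arithmetic] -/
theorem rankOne_term_eq_sum (a bcoef : ℝ) (c Δ : EuclideanSpace ℝ (Fin 3)) :
    a * ⟪c, Δ⟫ ^ 2 + bcoef * ‖Δ‖ ^ 2 = ∑ i, ∑ j, (a * (c i * c j) + (if i = j then bcoef else 0)) * (Δ i * Δ j) := by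
  rw [inner_sq_eq_sum, norm_sq_eq_sum, Finset.mul_sum, Finset.mul_sum, ← Finset.sum_add_distrib]
  refine Finset.sum_congr rfl fun i _ => ?_
  rw [Finset.mul_sum]
  have hdiag : ∑ j, (if i = j then bcoef else 0) * (Δ i * Δ j) = bcoef * Δ i ^ 2 := by
    rw [Finset.sum_eq_single i]
    · simp [sq]
    · intro j _ hji; simp [Ne.symm hji]
    · intro h; exact absurd (Finset.mem_univ i) h
  rw [← hdiag, ← Finset.sum_add_distrib]
  exact Finset.sum_congr rfl fun j _ => by ring

/-- ★★★ **CURVATURE-SUM FLOOR FROM HESSIAN-ENTRY ENCLOSURES.**  Labels `b ∈ B` with coefficients `α_b, β_b : ℝ` and vectors `c_b`; put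
`M i j := Σ_b (α_b (c_b)_i (c_b)_j + [i = j] β_b)` (the Hessian of the label sum).  If `lo ≤ M ≤ hi` entrywise and the end-point
dominance test `λ + Σ_{j≠i} max |lo i j| |hi i j| ≤ lo i i` holds for each `i`, then for every direction `Δ`:
`λ‖Δ‖² ≤ Σ_b (α_b ⟪c_b, Δ⟫² + β_b ‖Δ‖²)` — with §1 this is the `hcurv` hypothesis of `…HomConvexSegmentW45.hcpShifted_floor_W45`. [folklore chaining] -/
theorem curvatureSum_ge_of_enclosure {ι : Type*} (B : Finset ι) (α β : ι → ℝ) (c : ι → EuclideanSpace ℝ (Fin 3)) (lo hi : Fin 3 → Fin 3 → ℝ)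
    {lam : ℝ}
    (hlo : ∀ i j, lo i j ≤ ∑ b ∈ B, (α b * (c b i * c b j) + (if i = j then β b else 0)))
    (hhi : ∀ i j, ∑ b ∈ B, (α b * (c b i * c b j) + (if i = j then β b else 0)) ≤ hi i j)
    (htest : ∀ i, lam + (∑ j, if j = i then 0 else max |lo i j| |hi i j|) ≤ lo i i) (Δ : EuclideanSpace ℝ (Fin 3)) :
    lam * ‖Δ‖ ^ 2 ≤ ∑ b ∈ B, (α b * ⟪c b, Δ⟫ ^ 2 + β b * ‖Δ‖ ^ 2) := by
  set M : Fin 3 → Fin 3 → ℝ := fun i j => ∑ b ∈ B, (α b * (c b i * c b j) + (if i = j then β b else 0)) with hM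
  have hsym : ∀ i j, M i j = M j i := by
    intro i j
    simp only [hM]
    refine Finset.sum_congr rfl fun b _ => ?_
    by_cases h : i = j
    · subst h; rfl
    · rw [if_neg h, if_neg (Ne.symm h)]; ring
  have key := quadForm_ge_of_enclosure M lo hi hsym hlo hhi htest (fun i => Δ i)
  have hexp : ∑ b ∈ B, (α b * ⟪c b, Δ⟫ ^ 2 + β b * ‖Δ‖ ^ 2) = ∑ i, ∑ j, M i j * (Δ i * Δ j) := by
    calc ∑ b ∈ B, (α b * ⟪c b, Δ⟫ ^ 2 + β b * ‖Δ‖ ^ 2)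
        = ∑ b ∈ B, ∑ i, ∑ j, (α b * (c b i * c b j) + (if i = j then β b else 0)) * (Δ i * Δ j) :=
          Finset.sum_congr rfl fun b _ => rankOne_term_eq_sum (α b) (β b) (c b) Δ
      _ = ∑ i, ∑ b ∈ B, ∑ j, (α b * (c b i * c b j) + (if i = j then β b else 0)) * (Δ i * Δ j) := Finset.sum_comm
      _ = ∑ i, ∑ j, ∑ b ∈ B, (α b * (c b i * c b j) + (if i = j then β b else 0)) * (Δ i * Δ j) :=
          Finset.sum_congr rfl fun i _ => Finset.sum_comm
      _ = ∑ i, ∑ j, M i j * (Δ i * Δ j) :=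
          Finset.sum_congr rfl fun i _ => Finset.sum_congr rfl fun j _ => by rw [hM, Finset.sum_mul]
  rw [hexp, norm_sq_eq_sum]
  exact key

/-! ## §4. ★★★ The `hcurv` input of `hcpShifted_floor_W45` from enclosures -/

/-- ★★★ **THE CURVATURE-SUM FLOOR OF THE SEGMENT LEMMA FROM HESSIAN-ENTRY ENCLOSURES.**  At a parameter `s` with all radii
`ρ_b = ‖p_b + sΔ‖ ≠ 0`, put `α_b := (W₁′(ρ_b) − W₁(ρ_b)/ρ_b)/ρ_b²`, `β_b := W₁(ρ_b)/ρ_b`, `c_b := p_b + sΔ`.  Entrywise enclosures `lo ≤ M ≤ hi` of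
`M i j = Σ_b (α_b (c_b)_i (c_b)_j + [i = j] β_b)` passing the end-point dominance test with `λ` give `λ‖Δ‖² ≤ Σ_b segGd W₁ p_b Δ s` — the
`hcurv` hypothesis of `…HomConvexSegment.slope_growth_of_curvature_sum` / `…HomConvexSegmentW45.hcpShifted_floor_W45` at that parameter.
(A `λ`-leaf encloses `α_b, β_b, c_b` over its `(U, ξ)`-box × `s ∈ [0,1]` by interval arithmetic on the piecewise formulas of `W₄₅′, W₄₅″`.)
[folklore chaining: §1 + §3] -/
theorem segGd_sum_ge_of_enclosure {ι : Type*} (B : Finset ι) (W₁ : ℝ → ℝ) (p : ι → EuclideanSpace ℝ (Fin 3)) (Δ : EuclideanSpace ℝ (Fin 3))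
    {s : ℝ} (h0 : ∀ b ∈ B, segR (p b) Δ s ≠ 0) (lo hi : Fin 3 → Fin 3 → ℝ) {lam : ℝ}
    (hlo : ∀ i j, lo i j ≤ ∑ b ∈ B,
      ((deriv W₁ (segR (p b) Δ s) - W₁ (segR (p b) Δ s) / segR (p b) Δ s) / segR (p b) Δ s ^ 2 * ((p b + s • Δ) i * (p b + s • Δ) j) +
        (if i = j then W₁ (segR (p b) Δ s) / segR (p b) Δ s else 0)))
    (hhi : ∀ i j, ∑ b ∈ B,
      ((deriv W₁ (segR (p b) Δ s) - W₁ (segR (p b) Δ s) / segR (p b) Δ s) / segR (p b) Δ s ^ 2 * ((p b + s • Δ) i * (p b + s • Δ) j) +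
        (if i = j then W₁ (segR (p b) Δ s) / segR (p b) Δ s else 0)) ≤ hi i j)
    (htest : ∀ i, lam + (∑ j, if j = i then 0 else max |lo i j| |hi i j|) ≤ lo i i) :
    lam * ‖Δ‖ ^ 2 ≤ ∑ b ∈ B, segGd W₁ (p b) Δ s := by
  have key := curvatureSum_ge_of_enclosure B
    (fun b => (deriv W₁ (segR (p b) Δ s) - W₁ (segR (p b) Δ s) / segR (p b) Δ s) / segR (p b) Δ s ^ 2)
    (fun b => W₁ (segR (p b) Δ s) / segR (p b) Δ s) (fun b => p b + s • Δ) lo hi hlo hhi htest Δ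
  refine key.trans (le_of_eq ?_)
  exact Finset.sum_congr rfl fun b hb => (segGd_eq_rankOne W₁ (p b) Δ (h0 b hb)).symm

/-! ## §5. ★★ The SLOPE certificate `G` from enclosures of the gradient vector -/

/-- At `s = 0` the slope term is linear in `Δ`: `segG W₁ p Δ 0 = (W₁‖p‖/‖p‖)·⟪p, Δ⟫` (`p ≠ 0`). [arithmetic] -/
theorem segG_zero_eq (W₁ : ℝ → ℝ) (p Δ : EuclideanSpace ℝ (Fin 3)) :
    segG W₁ p Δ 0 = W₁ ‖p‖ / ‖p‖ * ⟪p, Δ⟫ := by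
  have hR : segR p Δ 0 = ‖p‖ := by simp [segR]
  have hN : segN p Δ 0 = ⟪p, Δ⟫ := by rw [segN_eq_inner]; simp
  unfold segG segS
  rw [hR, hN]
  ring

/-- ★★ **SLOPE BOUND FROM GRADIENT ENCLOSURES.**  The slope of the label sum at the base point is `⟪g, Δ⟫` with the GRADIENT VECTOR
`g = Σ_b (W₁‖p_b‖/‖p_b‖)·p_b`; coordinate enclosures `lo_i ≤ g_i ≤ hi_i` with `Σ_i max |lo_i| |hi_i| ≤ G` (an `ℓ¹` bound, sound since
`|⟪g, Δ⟫| ≤ Σ_i |g_i||Δ_i| ≤ (Σ_i |g_i|)·‖Δ‖`) give `|Σ_b segG W₁ p_b Δ 0| ≤ G‖Δ‖` — the `hG` input of `…HomConvexSegmentW45.hcpShifted_floor_W45`. [folklore] -/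
theorem slopeSum_abs_le_of_enclosure {ι : Type*} (B : Finset ι) (W₁ : ℝ → ℝ) (p : ι → EuclideanSpace ℝ (Fin 3)) (lo hi : Fin 3 → ℝ) {G : ℝ}
    (hlo : ∀ i, lo i ≤ ∑ b ∈ B, W₁ ‖p b‖ / ‖p b‖ * p b i) (hhi : ∀ i, ∑ b ∈ B, W₁ ‖p b‖ / ‖p b‖ * p b i ≤ hi i)
    (hG : ∑ i, max |lo i| |hi i| ≤ G) (Δ : EuclideanSpace ℝ (Fin 3)) :
    |∑ b ∈ B, segG W₁ (p b) Δ 0| ≤ G * ‖Δ‖ := by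
  -- the slope sum is `Σ_i g_i Δ_i`
  have hsum : ∑ b ∈ B, segG W₁ (p b) Δ 0 = ∑ i, (∑ b ∈ B, W₁ ‖p b‖ / ‖p b‖ * p b i) * Δ i := by
    calc ∑ b ∈ B, segG W₁ (p b) Δ 0 = ∑ b ∈ B, ∑ i, W₁ ‖p b‖ / ‖p b‖ * p b i * Δ i := by
          refine Finset.sum_congr rfl fun b _ => ?_
          rw [segG_zero_eq, inner_eq_sum3, Finset.mul_sum]
          exact Finset.sum_congr rfl fun i _ => by ring
      _ = ∑ i, ∑ b ∈ B, W₁ ‖p b‖ / ‖p b‖ * p b i * Δ i := Finset.sum_comm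
      _ = ∑ i, (∑ b ∈ B, W₁ ‖p b‖ / ‖p b‖ * p b i) * Δ i :=
          Finset.sum_congr rfl fun i _ => by rw [Finset.sum_mul]
  rw [hsum]
  -- coordinatewise: |g_i Δ_i| ≤ max|lo||hi| · ‖Δ‖
  have hcoord : ∀ i, |Δ i| ≤ ‖Δ‖ := fun i => by
    have := EuclideanSpace.norm_eq Δ ▸ Real.sqrt_le_sqrt (Finset.single_le_sum (fun j _ => sq_nonneg (‖Δ j‖)) (Finset.mem_univ i))
    rw [Real.norm_eq_abs, Real.sqrt_sq (abs_nonneg _)] at this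
    exact this
  have hg : ∀ i, |∑ b ∈ B, W₁ ‖p b‖ / ‖p b‖ * p b i| ≤ max |lo i| |hi i| := fun i => abs_le_max_abs_abs (hlo i) (hhi i)
  calc |∑ i, (∑ b ∈ B, W₁ ‖p b‖ / ‖p b‖ * p b i) * Δ i|
      ≤ ∑ i, |(∑ b ∈ B, W₁ ‖p b‖ / ‖p b‖ * p b i) * Δ i| := Finset.abs_sum_le_sum_abs _ _
    _ = ∑ i, |∑ b ∈ B, W₁ ‖p b‖ / ‖p b‖ * p b i| * |Δ i| := Finset.sum_congr rfl fun i _ => abs_mul _ _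
    _ ≤ ∑ i, max |lo i| |hi i| * ‖Δ‖ :=
        Finset.sum_le_sum fun i _ => mul_le_mul (hg i) (hcoord i) (abs_nonneg _) ((abs_nonneg _).trans (hg i))
    _ = (∑ i, max |lo i| |hi i|) * ‖Δ‖ := by rw [Finset.sum_mul]
    _ ≤ G * ‖Δ‖ := mul_le_mul_of_nonneg_right hG (norm_nonneg _)

end Summit.AtomisticToContinuum.Crystallization.Theorems.FrustratedLawDichotomyStrainedPatchHomConvexCurvature

end
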